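import Summits.HubbardSuperconductivity.HubbardSuperconductivity.Theses.AposterioriCapRg
import Literature.MathematicalPhysics.QuantumLattice.DWaveOrderParameterProofs

/-!
# Crux `AposterioriOrderCriterionR` (item `stmt-HubbardSuperconductivity-13884`): load-bearing analysis

The crux (`Theses.AposterioriCapRg.AposterioriOrderCriterionR`, route AposterioriCapRg, rank 5) is
`∃ kStar etaStar > 0, ∀ U μ h₀ (D : HubbardScaleData), 0 < h₀ → (∀ h ∈ Ioc 0 h₀, ∃ L₀,
D.IsCertifiedEnclosure (hubbardScaleReportCT U μ D h) L₀) → D.MeetsThresholds kStar etaStar →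
(D.meanFieldDensity.fst : ℝ)/2 ≤ dWaveOrderParameter U μ`.  Negative-side lemmas (standing disprover,
cdisprove cycle 1; no definition is introduced, every mutated statement is spelled out):

* `meetsThresholds_blind_to_meanFieldDensity` — for every `k, e ≥ 0` and EVERY rational `m` there is a
  0-patch datum meeting `MeetsThresholds k e` with `meanFieldDensity.fst = m`: the thresholds never read
  `m₀`, and at `numPatches = 0` their velocity clauses are decorative.
* `aposterioriOrderCriterionR_false_without_enclosure` — the crux with the ENCLOSURE HYPOTHESIS DROPPED is
  FALSE (that datum with `fst/2 > dWaveOrderParameter 0 0`): any proof must use the report.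
* `aposterioriOrderCriterionR_false_of_univ_report` — the crux with `hubbardScaleReportCT` replaced by the
  all-realising report is FALSE; `aposterioriOrderCriterionR_of_empty_report_shape` — with the empty
  report it is (vacuously) TRUE: the crux's truth value is exactly the honesty of the landed report in its
  `meanFieldDensity` coordinate (the tree proves `hubbardScaleReportCT ≠ univ` and "never certified if empty").
* `isRealisedAtCT_noPatch_velocities`, `mem_hubbardScaleReportCTAt_noPatch_velocities` — at `numPatches = 0`
  the landed CT predicate / report never reads `fermiVelocity`, `gapVelocity` (crux [3] excludes 0-patch data
  in ITS conclusion by `0 < D.numPatches`; R's hypothesis does not, so a proof of R must cover them, with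
  `(kStar Λ₀)² ≤ ρ_s κ` and `η ≤ etaStar` as the only threshold content).
* `aposterioriOrderCriterionR_conclusion_of_fst_nonpos`, `exists_certified_pos_of_not_aposterioriOrderCriterionR`
  — the conclusion is free whenever `meanFieldDensity.fst ≤ 0` (`dWaveOrderParameter_nonneg`); hence a
  refutation needs, for every threshold pair, a CERTIFIED datum with `0 < fst`, i.e. an `h`-uniform positive floor under the model's
  `scaleMeanFieldDensityCT` — at `U = 0` (the only coupling with exhibited reported tuples,
  `isRealisedAtCT_free_noPatch`) the honest value is the free BdG anomalous density `O(h log(1/h)) → 0`.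

Workfile with the paper attack log: `Cruxes/AposterioriOrderCriterionR/Disproof.lean`.
-/

noncomputable section

namespace Summit.HubbardSuperconductivity.HubbardSuperconductivity.Theorems.AposterioriOrderCriterionR.Negative

open Literature.MathematicalPhysics.QuantumLattice
open Summit.HubbardSuperconductivity.HubbardSuperconductivity.Theses.AposterioriCapRg
open Filter Set

/-! ### Helpers -/

/-- `k · (1/(k²+1)) ≤ 1` for every rational `k`. [folklore] -/
theorem mul_one_div_sq_add_one_le_one (k : ℚ) : k * (1 / (k ^ 2 + 1)) ≤ 1 := by
  rw [mul_one_div, div_le_one (by positivity)]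
  nlinarith [sq_nonneg (k - 1)]

/-- For every real `B` there is a rational `m` with `B < m/2`. [folklore] -/
theorem exists_rat_half_gt (B : ℝ) : ∃ m : ℚ, B < ((m : ℚ) : ℝ) / 2 := by
  refine ⟨2 * (⌈B⌉₊ : ℚ) + 2, ?_⟩
  have h := Nat.le_ceil B
  push_cast
  linarith

/-- Every scale datum encloses the tuple of its own left end points. [folklore] -/
theorem encloses_fst_tuple (D : HubbardScaleData) :
    D.Encloses ⟨fun i => (D.gap i).fst, D.stiffness.fst, D.compressibility.fst, D.fermiVelocity.fst,
      D.gapVelocity.fst, D.remainderNorm.fst, D.meanFieldDensity.fst⟩ := by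
  refine ⟨fun i => ?_, ?_, ?_, ?_, ?_, ?_, ?_⟩ <;>
    exact NonemptyInterval.cast_mem_ratCast_iff.2 ⟨le_rfl, NonemptyInterval.fst_le_snd _⟩

/-! ### The thresholds are blind to the mean-field density -/

/-- **`MeetsThresholds` never reads `meanFieldDensity`, and at `numPatches = 0` its velocity clauses are
decorative**: for all `k ≥ 0`, `e ≥ 0` and EVERY `m : ℚ` the 0-patch datum with scale `1/(k²+1)`,
stiffness = compressibility = velocities = `[1,1]`, remainder `[0,0]`, mean-field density `[m,m]` meets
`MeetsThresholds k e`. [folklore] -/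
theorem meetsThresholds_blind_to_meanFieldDensity {k e : ℚ} (hk : 0 ≤ k) (he : 0 ≤ e) (m : ℚ) :
    ∃ D : HubbardScaleData, D.numPatches = 0 ∧ D.meanFieldDensity.fst = m ∧ D.MeetsThresholds k e := by
  refine ⟨HubbardScaleData.mk (1 / (k ^ 2 + 1)) (by positivity) 0 ∅ Fin.elim0
    ⟨(1, 1), le_rfl⟩ ⟨(1, 1), le_rfl⟩ ⟨(1, 1), le_rfl⟩ ⟨(1, 1), le_rfl⟩ ⟨(0, 0), le_rfl⟩ ⟨(m, m), le_rfl⟩,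
    rfl, rfl, ?_⟩
  have h1 : k * (1 / (k ^ 2 + 1)) ≤ 1 := mul_one_div_sq_add_one_le_one k
  have h0 : 0 ≤ k * (1 / (k ^ 2 + 1)) := mul_nonneg hk (by positivity)
  refine ⟨zero_lt_one, zero_lt_one, zero_lt_one, ?_, ?_, ?_, fun i => i.elim0, he⟩
  · show k * (1 / (k ^ 2 + 1)) * 1 ≤ 1
    simpa using h1
  · show k * (1 / (k ^ 2 + 1)) * 1 ≤ 1
    simpa using h1
  · show (k * (1 / (k ^ 2 + 1))) ^ 2 ≤ 1 * 1
    nlinarith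

/-! ### The enclosure hypothesis is load-bearing; the report's honesty is the crux's truth value -/

/-- **R is FALSE without its enclosure hypothesis** ("thresholds ⇒ order"): the thresholds are met with an
arbitrarily large `meanFieldDensity.fst` (take `fst/2 > dWaveOrderParameter 0 0`, a fixed real
number).  Any proof of the crux must use the report. [folklore] -/
theorem aposterioriOrderCriterionR_false_without_enclosure :
    ¬ (∃ kStar etaStar : ℚ, 0 < kStar ∧ 0 < etaStar ∧ ∀ (U μ h₀ : ℝ) (D : HubbardScaleData), 0 < h₀ →
        D.MeetsThresholds kStar etaStar → ((D.meanFieldDensity.fst : ℚ) : ℝ) / 2 ≤ dWaveOrderParameter U μ) := by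
  rintro ⟨k, e, hk, he, H⟩
  obtain ⟨m, hm⟩ := exists_rat_half_gt (dWaveOrderParameter 0 0)
  obtain ⟨D, -, hDm, hD⟩ := meetsThresholds_blind_to_meanFieldDensity hk.le he.le m
  have := H 0 0 1 D one_pos hD
  rw [hDm] at this
  linarith

/-- **R is FALSE over the all-realising report**: replacing `hubbardScaleReportCT U μ D h` by `Set.univ`
certifies every datum from `L₀ = 0`, and the `m₀`-blind thresholds do the rest.  (The tree proves
`hubbardScaleReportCT_ne_univ`; this lemma says WHY that matters.) [folklore] -/
theorem aposterioriOrderCriterionR_false_of_univ_report :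
    ¬ (∃ kStar etaStar : ℚ, 0 < kStar ∧ 0 < etaStar ∧ ∀ (U μ h₀ : ℝ) (D : HubbardScaleData), 0 < h₀ →
        (∀ h ∈ Set.Ioc (0:ℝ) h₀, ∃ L₀ : ℕ, D.IsCertifiedEnclosure (fun _ _ => Set.univ) L₀) →
        D.MeetsThresholds kStar etaStar → ((D.meanFieldDensity.fst : ℚ) : ℝ) / 2 ≤ dWaveOrderParameter U μ) := by
  rintro ⟨k, e, hk, he, H⟩
  obtain ⟨m, hm⟩ := exists_rat_half_gt (dWaveOrderParameter 0 0)
  obtain ⟨D, -, hDm, hD⟩ := meetsThresholds_blind_to_meanFieldDensity hk.le he.le m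
  have hcert : ∀ h ∈ Set.Ioc (0:ℝ) 1, ∃ L₀ : ℕ, D.IsCertifiedEnclosure (fun _ _ => Set.univ) L₀ :=
    fun h _ => ⟨0, fun L _ => ⟨0, fun β _ => ⟨_, Set.mem_univ _, encloses_fst_tuple D⟩⟩⟩
  have := H 0 0 1 D one_pos hcert hD
  rw [hDm] at this
  linarith

/-- **Over the EMPTY report the crux's shape is vacuously true** (no datum is certified, `h = h₀` already
fails): an over-strict report would hide falsity — the other half of "truth value = report honesty".
[folklore] -/
theorem aposterioriOrderCriterionR_of_empty_report_shape :
    ∃ kStar etaStar : ℚ, 0 < kStar ∧ 0 < etaStar ∧ ∀ (U μ h₀ : ℝ) (D : HubbardScaleData), 0 < h₀ →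
        (∀ h ∈ Set.Ioc (0:ℝ) h₀, ∃ L₀ : ℕ, D.IsCertifiedEnclosure (fun _ _ => (∅ : Set _)) L₀) →
        D.MeetsThresholds kStar etaStar → ((D.meanFieldDensity.fst : ℚ) : ℝ) / 2 ≤ dWaveOrderParameter U μ := by
  refine ⟨1, 1, one_pos, one_pos, fun U μ h₀ D hh₀ hcert _ => ?_⟩
  obtain ⟨L₀, hL₀⟩ := hcert h₀ ⟨hh₀, le_rfl⟩
  exact absurd hL₀ (HubbardScaleData.not_isCertifiedEnclosure_empty L₀)

/-- **The crux is antitone in the report**: it implies its own variant over any SMALLER report family, in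
particular over the bare-frame v1 report `hubbardScaleReport ⊆ hubbardScaleReportCT`
(`hubbardScaleReport_subset_CT`) — recorded so that no v1 result is imported in the wrong direction.
[folklore] -/
theorem aposterioriOrderCriterionR_v1_shape_of_crux (H : AposterioriOrderCriterionR) :
    ∃ kStar etaStar : ℚ, 0 < kStar ∧ 0 < etaStar ∧ ∀ (U μ h₀ : ℝ) (D : HubbardScaleData), 0 < h₀ →
        (∀ h ∈ Set.Ioc (0:ℝ) h₀, ∃ L₀ : ℕ, D.IsCertifiedEnclosure (hubbardScaleReport U μ D h) L₀) →
        D.MeetsThresholds kStar etaStar → ((D.meanFieldDensity.fst : ℚ) : ℝ) / 2 ≤ dWaveOrderParameter U μ := by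
  obtain ⟨k, e, hk, he, H⟩ := H
  refine ⟨k, e, hk, he, fun U μ h₀ D hh₀ hcert hthr => H U μ h₀ D hh₀ (fun h hh => ?_) hthr⟩
  obtain ⟨L₀, hL₀⟩ := hcert h hh
  exact ⟨L₀, isCertifiedEnclosure_reportCT_of_report hL₀⟩

/-! ### 0-patch data: the landed CT report never reads the velocities -/

/-- **At `numPatches = 0` the CT normal-form predicate never reads `fermiVelocity` / `gapVelocity`** (no nodal
pin can be stated over `Fin 0`). [folklore] -/
theorem isRealisedAtCT_noPatch_velocities {L M : ℕ} [NeZero L] {β U μ h Λ₀ : ℝ} {K : TrigPolyC4v}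
    {nodal : Finset (Fin 0)} {p : HubbardScaleData.Parameters 0}
    (hp : IsRealisedAtCT L M β U μ h K Λ₀ 0 nodal p) (vF vΔ : ℝ) :
    IsRealisedAtCT L M β U μ h K Λ₀ 0 nodal { p with fermiVelocity := vF, gapVelocity := vΔ } := by
  obtain ⟨hβ, q, heven, hgap, hsign, -, hρ, hκ, hm, hη⟩ := hp
  exact ⟨hβ, q, heven, hgap, hsign, fun i _ => i.elim0, hρ, hκ, hm, hη⟩

/-- **… hence the 0-patch CT report is closed under arbitrary changes of both velocities**: for 0-patch data
the clauses `kStar·Λ₀·v_F ≤ ρ_s.fst`, `kStar·Λ₀·v_Δ ≤ ρ_s.fst` of `MeetsThresholds` are decorative (enclose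
`v` by `[ρ_s.fst/(kStar Λ₀), ρ_s.fst/(kStar Λ₀)]` whenever `ρ_s.fst > 0`). [folklore] -/
theorem mem_hubbardScaleReportCTAt_noPatch_velocities {U μ h Λ₀ : ℝ} {nodal : Finset (Fin 0)} {L : ℕ}
    {β : ℝ} {p : HubbardScaleData.Parameters 0} (hp : p ∈ hubbardScaleReportCTAt U μ h Λ₀ 0 nodal L β)
    (vF vΔ : ℝ) :
    { p with fermiVelocity := vF, gapVelocity := vΔ } ∈ hubbardScaleReportCTAt U μ h Λ₀ 0 nodal L β := by
  rcases Nat.eq_zero_or_pos L with rfl | hL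
  · simp at hp
  · haveI : NeZero L := NeZero.of_pos hL
    rw [mem_hubbardScaleReportCTAt_iff] at hp ⊢
    intro δ hδ
    refine (hp δ hδ).mono fun M hM => ?_
    obtain ⟨K, hK, p', hp', hclose⟩ := hM
    refine ⟨K, hK, { p' with fermiVelocity := vF, gapVelocity := vΔ },
      isRealisedAtCT_noPatch_velocities hp' vF vΔ, ?_⟩
    obtain ⟨h1, h2, h3, -, -, h6, h7⟩ := hclose
    exact ⟨h1, h2, h3, by simp [hδ], by simp [hδ], h6, h7⟩

/-! ### Where a refutation must live -/

/-- **A datum with `meanFieldDensity.fst ≤ 0` satisfies the crux's conclusion at every `(U, μ)`**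
(`dWaveOrderParameter_nonneg`). [folklore] -/
theorem aposterioriOrderCriterionR_conclusion_of_fst_nonpos (D : HubbardScaleData)
    (hD : D.meanFieldDensity.fst ≤ 0) (U μ : ℝ) :
    ((D.meanFieldDensity.fst : ℚ) : ℝ) / 2 ≤ dWaveOrderParameter U μ := by
  have : ((D.meanFieldDensity.fst : ℚ) : ℝ) ≤ 0 := by exact_mod_cast hD
  linarith [dWaveOrderParameter_nonneg U μ]

/-- **The shape of every possible refutation.**  If the crux fails, then for EVERY pair of positive
thresholds there are a point `(U, μ)`, an `h₀ > 0` and a datum `D` meeting them, CERTIFIED against the CT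
report on all of `(0, h₀]`, with `0 < D.meanFieldDensity.fst` and `dWaveOrderParameter U μ < fst/2` — i.e.
an `h`-UNIFORM positive floor under the model's scale mean-field density `scaleMeanFieldDensityCT L M β U μ h K Λ₀`
along `M → ∞`, `L ≥ L₀(h)`, `β ≥ β₀(L)`: mean-field-at-scale symmetry breaking, unavailable at `U = 0` (free
BdG density `O(h log(1/h))`) and not computable at `U ≠ 0` in the tree today. [folklore] -/
theorem exists_certified_pos_of_not_aposterioriOrderCriterionR (hR : ¬ AposterioriOrderCriterionR)
    {kStar etaStar : ℚ} (hk : 0 < kStar) (he : 0 < etaStar) :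
    ∃ (U μ h₀ : ℝ) (D : HubbardScaleData), 0 < h₀ ∧
      (∀ h ∈ Set.Ioc (0:ℝ) h₀, ∃ L₀ : ℕ, D.IsCertifiedEnclosure (hubbardScaleReportCT U μ D h) L₀) ∧
      D.MeetsThresholds kStar etaStar ∧ 0 < D.meanFieldDensity.fst ∧
      dWaveOrderParameter U μ < ((D.meanFieldDensity.fst : ℚ) : ℝ) / 2 := by
  by_contra hno
  push Not at hno
  refine hR ⟨kStar, etaStar, hk, he, fun U μ h₀ D hh₀ hcert hthr => ?_⟩
  rcases le_or_gt D.meanFieldDensity.fst 0 with hle | hpos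
  · exact aposterioriOrderCriterionR_conclusion_of_fst_nonpos D hle U μ
  · exact hno U μ h₀ D hh₀ hcert hthr hpos

/-- **Certification is not vacuous in the remainder coordinate**: a datum certified against the CT report at
one `h` has `0 ≤ remainderNorm.snd` (contrapositive of the tree's
`not_isCertifiedEnclosure_reportCT_of_remainderNorm_snd_neg`). [folklore] -/
theorem remainderNorm_snd_nonneg_of_certified {U μ h : ℝ} {D : HubbardScaleData} {L₀ : ℕ}
    (hD : D.IsCertifiedEnclosure (hubbardScaleReportCT U μ D h) L₀) : 0 ≤ D.remainderNorm.snd := by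
  by_contra hneg
  exact not_isCertifiedEnclosure_reportCT_of_remainderNorm_snd_neg U μ h D (lt_of_not_ge hneg) L₀ hD

end Summit.HubbardSuperconductivity.HubbardSuperconductivity.Theorems.AposterioriOrderCriterionR.Negative
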